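import Summits.KontsevichZagierPeriods.KontsevichZagierPeriods.Theses.HurwitzMicroSectors
import Literature.NumberTheory.Transcendental.BoxCoordinatePowerMap
import Summits.KontsevichZagierPeriods.KontsevichZagierPeriods.Theorems.HurwitzMicroSectorsDilationMoveStubIsSemialgebraicMapOnCoordPow
import Summits.KontsevichZagierPeriods.KontsevichZagierPeriods.Theorems.HurwitzMicroSectorsDilationMoveStubOrthantCoordPowMove

/-!
# `DilationMove` (stmt-KontsevichZagierPeriods-3872, route HurwitzMicroSectors) — line
`coordpow-api-assembly`

The crux: for `m ≥ 1` and representations `r, r'` of the Kontsevich–Zagier calculus on the open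
unit box `(0,1)ⁿ` with `r.integrand x = r'.integrand (xᵢᵐ)ᵢ · mⁿ ∏ᵢ xᵢ^(m-1)` on the box,
`[r] − [r']` is ONE change-of-variables generator (`KZ.changeOfVariablesRel`, rule (2) of
[Kontsevich–Zagier 2001, §1.2]) — the "dilation move" realising the Hurwitz distribution relations
`Σ_{j<m} ζ(w, (a+j)/m) = mʷ ζ(w, a)` of the box sectors as single moves of the calculus.

Line: the witness is `Φ = BoxIntegral.coordPow m` (`x ↦ (xᵢᵐ)ᵢ`) with derivative
`Φ' = BoxIntegral.coordPowDeriv m` from `Literature/NumberTheory/Transcendental/BoxCoordinatePowerMap.lean`,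
which proves differentiability, injectivity on the nonnegative orthant, `Φ '' (0,1)ⁿ = (0,1)ⁿ` and
`det Φ'(x) = mⁿ ∏ xᵢ^(m-1)`. The two registered stubs, landed as their own files:

* `stub_isSemialgebraicMapOn_coordPow` (`…Theorems.HurwitzMicroSectorsDilationMoveStubIsSemialgebraicMapOnCoordPow`)
  — the polynomial map `(Xᵢ^m)ᵢ` is `ℚ`-semialgebraic on every `ℚ`-semialgebraic set;
* `stub_orthantCoordPowMove` (`…Theorems.HurwitzMicroSectorsDilationMoveStubOrthantCoordPowMove`)
  — the move on ANY domain inside the open orthant `{x | ∀ i, 0 < xᵢ}` with target `Φ '' r.domain`;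

and the composition `DilationMove_of` below specialises to the unit box via
`BoxIntegral.image_coordPow_box`. Every hypothesis is load-bearing (see
`Theorems/DilationMove/Negative/LoadBearing.lean`: dropping `1 ≤ m`, either box hypothesis, or the
Jacobian factor gives a false statement; the factor `(mⁿ, m-1)` is the unique valid monomial one).
-/

noncomputable section

open Set MeasureTheory
open Literature.NumberTheory.Transcendental
open Literature.ModelTheory.ExponentialFields (IsSemialgebraic)

namespace Summit.KontsevichZagierPeriods.HurwitzMicroSectors.DilationMove

open Summit.KontsevichZagierPeriods.KontsevichZagierPeriods.Theses.HurwitzMicroSectors (DilationMove)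

/-- **The dilation move** (crux `DilationMove`, stmt-KontsevichZagierPeriods-3872). For every
dimension `n`, every `m ≥ 1`, and representations `r, r'` on the open unit box `(0,1)ⁿ` with
`r.integrand x = r'.integrand (xᵢᵐ)ᵢ · mⁿ ∏ᵢ xᵢ^(m-1)` on the box, `[r] − [r']` is one
change-of-variables generator of the Kontsevich–Zagier calculus: on the open unit box the orthant
move `stub_orthantCoordPowMove` applies (`0 < xᵢ`; tameness by `stub_isSemialgebraicMapOn_coordPow`),
and its target domain `Φₘ '' (0,1)ⁿ` is the unit box again (`BoxIntegral.image_coordPow_box`,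
`m ≠ 0`). [Kontsevich–Zagier 2001, §1.2, rule (2)] -/
theorem DilationMove_of : DilationMove := by
  intro n m hm r r' hr hr' hint
  have hm0 : m ≠ 0 := by omega
  have hsub : r.domain ⊆ {x | ∀ i, 0 < x i} := by
    rw [hr]
    exact fun x hx i => (hx i).1
  refine stub_orthantCoordPowMove n m hm r r' hsub
    (stub_isSemialgebraicMapOn_coordPow n m r.domain r.isSemialgebraic_domain) ?_ ?_
  · rw [hr', hr]
    exact (BoxIntegral.image_coordPow_box hm0).symm
  · intro x hx
    exact hint x hx

end Summit.KontsevichZagierPeriods.HurwitzMicroSectors.DilationMove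

end
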